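import Summits.NavierStokesRegularity.NavierStokesRegularity.Theorems.StrainDoorsDefs
import HarnessLib

/-!
# IsotropicBlobDefs — ROUND-41 «IsotropicBlobPressureLaw ⇒ ParityByShape ⇒ SubParityWitness»: texts of record

P0-42a (LEAD S-door ns-s30-p1 g4, PLATE MAP v2 2026-08-28T22:26:09Z): nsreg-p1 g33's `r41/Sketch45.lean` sha16
04c680584730f646 (ROUND-41 memo e24c66f1357e440e / edf2472c41fc8961 with §11) LANDED VERBATIM — §1 ParityByShape
threshold algebra (`shapeParam`, `isoFeedRatio`, `isoFeed`, `one_le_isoFeedRatio_iff`, …), §2 the exact-derivative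
identities (`sPart_exact`, `wPart_exact`, `crossPart_defect`), §3 the typed statements (`IsDecayingPressureOf`,
`isoField`, `dev`, `crossCoeff`, `IsotropicBlobPressureLaw`, `ArgmaxFeedParityOf`/`ArgmaxFeedParity` (τ1),
`SubParityWitnessOf`, `argmaxFeedParityOf_mono`, `subParityWitnessOf_mono`, `not_argmaxFeedParityOf_of_witness`,
`not_argmaxFeedParityOf_of_smooth_witness`) and the witness data (`uniaxialFun`, `uniaxialS`, `bump`, `dbump`, `polyEnv`,
`dpolyEnv`, `witnessField`, `witnessFieldC2`), §4 recorded constants (`example`s). Every declaration byte-identical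
(one-line docstrings ADDED on three §1 value lemmas for the gate's lint), order preserved (namespace `…Theorems.StrainDoors.IsotropicBlob`, `abbrev E3` kept); cut prepared by ns-s29-p2 g5,
`--supports stmt-NavierStokesRegularity-0056 --as helper`, `--kind definition`. The sketch's module docstring follows
verbatim. The kernel path to `SubParityWitnessOf 2 (9/14)` BY NAME (plates E0–E3, S, G, P, L, Z, V, W2, W3) lands in
separate `HarmonicShell…` / `IsotropicBlob…` files.

HONEST FRAME: a kinematic slice law and typed statements about it (τ1 and its witnesses) that CALIBRATE the S40/S41
clock doors; `IsotropicBlobPressureLaw` and `ArgmaxFeedParityOf` are Props, not proved here; items 0056 `NoTypeII`,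
10661 and NS regularity are NOT proved; nothing here is a route or a summit statement.
-/

/-!
# Sketch45 — ROUND-41 «IsotropicBlobPressureLaw ⇒ ParityByShape ⇒ SobolevSubParityWitness» (nsreg-p1 g33)

The σ1 USEFULNESS TEST of the strain-clock feed ratio `H/Λ²` (ref3 g27, SCORE-p1-ROUND-39) and the g32 seed τ1
(«is `H ≥ Λ²` at every global strain argmax of every smooth div-free field?»), answered in the FINITE-ENERGY frame.

**The law (proved off-kernel this round; the analytic heart — the exact-derivative identities — is kernel-checked in §2).**
Let `S ∈ Sym₀(3)`, `W ∈ so(3)` and let `h, k : ℝ → ℝ` be smooth with compact support in `(-∞, 1]` (profiles in the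
variable `|x|²`).  The ISOTROPIC ENVELOPE of the linear field `x ↦ (S + W)x` is the smooth, compactly supported,
divergence-free field
  `u(x) = (h(|x|²) + ⅔|x|² h′(|x|²))·Sx − ⅔ h′(|x|²)⟪x,Sx⟫·x + k(|x|²)·Wx`     (`= curl(h(|x|²)·⅓(Sx × x)) + k(|x|²)Wx`),
the general rotation-equivariant divergence-free envelope of a linear field; `∇u(0) = h(0)S + k(0)W`, `u(0) = 0`.
Let `p` be its DECAYING pressure (`Δp = −tr((∇u)²)`, `p → 0` at infinity).  Then the trace-free pressure Hessian
at the centre is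
  `Π(0) = −(2/7)·h(0)²·dev(S²) − (2/5)·k(0)²·dev(W²) + γ·(SW − WS)`,  `γ = −(2/5)·( h(0)k(0) + (8/3)∫₀^∞ h′(s)k(s) ds )`:
the `S²` and `W²` coefficients do NOT depend on the envelopes (`γ` does; non-isotropic truncations do).  These are
exactly the Wilczek–Meneveau coefficients `α = −2/7`, `β = −2/5` of the Gaussian conditional pressure Hessian
(J. Fluid Mech. 756 (2014), arXiv:1401.3351, eq. for `⟨H̃|A⟩`; `γ` there depends on the correlation function) —
here as a DETERMINISTIC single-field identity (the Gaussian conditional-mean field is one isotropic envelope).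
PROOF (r41/lawproof.py, exact ℚ arithmetic + this file's §2): Newton potential of a radial×(degree-2 harmonic)
density ⇒ `Π(0) = −(2/5)∫₀^∞ c(t) dt/t · Q` where `c(t)·(x̂·Qx̂)` is the `ℓ = 2` spherical-harmonic part of
`f(t x̂)`, `f = ½|ω|² − |S_u|²`; equivariance ⇒ `Q ∈ {dev(S²), dev(W²), SW − WS}`; the angular projections are
finite computations giving, with `g(t) = h(t²)`, `c(t) = k(t²)`… `G₀ = g, G₁ = t g′, G₂ = t² g″`:
  S-part  `c/t = (1/t)(−(12/7)G₀G₁ − (2/7)G₀G₂ − (4/21)G₁² + (2/21)G₁G₂) = d/dt[−(5/7)g² − (2/7)t g g′ + (1/21)t² g′²]`,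
  W-part  `c/t = −2 c c′ = d/dt[−c²]`,   cross part `c/t = d/dt[−g c + (t/3) g′ c] + (8/3) g′ c` (NOT exact),
so the radial integrals telescope to the centre values: `(5/7)g(0)²`, `c(0)²` (§2 below = these product rules).

**Corollary (ArgmaxFeedLaw / ParityByShape).** `(SW − WS)(ē,ē) = 0` for every eigenvector `ē` of `S`, so along the
top eigenvector (`Sē = Λē`) the STRAIN FEED of the tree (`strainFeed`, S37) at the centre of an isotropic blob is
universal:  `H/Λ² = 1 + (5/7)(s − 1) + (|ω|² − 3⟪ω,ē⟫²)/(20Λ²)`,  `s := |S|²_F/(3Λ²) ∈ [½, 2]`.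
Vorticity-free centre: FEED PARITY `H ≥ Λ²` ⇔ `s ≥ 1` ⇔ `λ₂/λ₁ ≥ (√3 − 1)/2 ≈ 0.366` (§1, kernel-checked):
tube-forming isolated strain maxima are SUB-parity (the top strain decays at `t = 0`), sheet-forming ones beyond
`λ₂/λ₁ = 0.366` are SUPER-parity.  Values: uniaxial `(−½,−½,1)`: `9/14`; plane strain: `16/21`; DNS-typical
`3:1:−4`: `184/189`; `(1,1,−2)`: `12/7`; infinite linear flow (no truncation): exactly `1` (steady Euler).

**Witnesses (¬τ1).** (i) SMOOTH: the uniaxial isotropic blob with bump envelope `h(s) = exp(−3s/(1−s))` on `s < 1`,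
`0` beyond (`k = 0`): the origin is its GLOBAL strain argmax (`S_zz = Λ(1 − 2κρ² − 3κz²) + O(|x|⁴)`,
`κ = −h′(0)/h(0) = 3`; shells `|x| ≥ 0.1`: `λ_max ≤ 0.938Λ`, grid certificate r41/argmax_bump2.py — the steeper
bump `κ = 1` FAILS, edge-shell strain `1.76Λ`, recorded) and `H = (9/14)Λ² < Λ²` there (the law; independent
quadrature check `0.64266` vs `0.642857`, r41/lawcheck_bump.py): `SubParityWitnessOf ⊤ (9/14)`.  (ii) KERNEL PATH
(`C²`): envelope `(1−|x|²)₊⁴` — a piecewise-polynomial `C²` field with EXPLICIT decaying pressure (interior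
polynomial of degree 18, exterior `H₂/|x|⁵ + H₄/|x|⁹`, exact `C¹` glue, r41/pressure_k4.txt), centre Hessian
`−Λ²·diag(3/7, 3/7, 9/14)` read off the quadratic coefficients, shells `|x| ≥ 0.1`: `λ_max ≤ 0.922Λ`:
`SubParityWitnessOf 2 (9/14)`.  Hence the forward clock doors S40-D1/D4, S41-D5 are slice-satisfiable by
compactly supported divergence-free data with exact constants.

WHAT IS KERNEL-CHECKED HERE: §1 (the parity threshold algebra), §2 (the exact-derivative identities that make the
law envelope-free), §3 `not_argmaxFeedParityOf_of_witness` + the regularity monotonicity.  TYPED ONLY (Props):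
`IsotropicBlobPressureLaw`, `ArgmaxFeedParityOf n` (τ1 = `n = ⊤`), `SubParityWitnessOf n c`.  WHAT THIS IS NOT: not a door, not a regularity statement; item 0056
`NoTypeII` / NS regularity are NOT proved; no Literature fact is used as a hypothesis; nothing here is a route or a
summit statement (`--supports stmt-NavierStokesRegularity-0056 --as helper` if landed).  hard core evaded: NONE.
-/

set_option linter.dupNamespace false

noncomputable section

open MeasureTheory Set Function Filter Metric Real InnerProductSpace
open _root_.Topology
open scoped ENNReal NNReal RealInnerProductSpace ContDiff Laplacian
open Literature.Analysis Literature.Analysis.FluidPDE VectorCalculus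

namespace Summit.NavierStokesRegularity.NavierStokesRegularity.Theorems.StrainDoors.IsotropicBlob

open Summit.NavierStokesRegularity.NavierStokesRegularity.Theorems.ArgmaxDoors
open Summit.NavierStokesRegularity.NavierStokesRegularity.Theorems.StrainDoors

set_option maxSynthPendingDepth 3

/-- `ℝ³`. -/
abbrev E3 := EuclideanSpace ℝ (Fin 3)

/-! ## §1 ParityByShape — the threshold algebra (kernel-checked) -/

/-- support (definition): the SHAPE PARAMETER `s = |S|²_F/(3Λ²)` of a trace-free strain with eigenvalues
`(Λ, μ, −Λ−μ)`: `s = (Λ² + μ² + (Λ+μ)²)/(3Λ²)` (`s = ½` uniaxial tube-forming, `⅔` plane strain, `2` for `(Λ,Λ,−2Λ)`). -/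
def shapeParam (Λ μ : ℝ) : ℝ := (Λ ^ 2 + μ ^ 2 + (Λ + μ) ^ 2) / (3 * Λ ^ 2)

/-- support (definition): the ISOLATED-BLOB FEED RATIO `H/Λ² = 1 + (5/7)(s − 1)` at the vorticity-free centre of an
isotropic straining blob (corollary of the law: `H = ⅓|S|² − Π(ē,ē)`, `Π(ē,ē) = −(2/7)(Λ² − ⅓|S|²)`). -/
def isoFeedRatio (s : ℝ) : ℝ := 1 + 5 / 7 * (s - 1)

/-- support (definition): the same with vorticity `ω` at the centre (`ω² = |ω|²`, `ωe² = ⟪ω,ē⟫²`):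
`H = Λ²(1 + (5/7)(s−1)) + (|ω|² − 3⟪ω,ē⟫²)/20` (the `β = −2/5` term and the isotropic part `−Δp/3`; the `γ` term
vanishes along eigenvectors of `S`). -/
def isoFeed (Λ s ω2 ωe2 : ℝ) : ℝ := Λ ^ 2 * (1 + 5 / 7 * (s - 1)) + (ω2 - 3 * ωe2) / 20

/-- the uniaxial tube-forming shape `(1, −½, −½)` sits at `9/14` of parity. -/
theorem isoFeedRatio_uniaxial : isoFeedRatio (shapeParam 1 (-1 / 2)) = 9 / 14 := by
  norm_num [isoFeedRatio, shapeParam]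

/-- plane strain `(1, 0, −1)` sits at `16/21` of parity. -/
theorem isoFeedRatio_planeStrain : isoFeedRatio (shapeParam 1 0) = 16 / 21 := by
  norm_num [isoFeedRatio, shapeParam]

/-- the DNS-typical intense-strain shape `3 : 1 : −4` sits at `184/189 ≈ 0.974` of parity. -/
theorem isoFeedRatio_threeOneFour : isoFeedRatio (shapeParam 3 1) = 184 / 189 := by
  norm_num [isoFeedRatio, shapeParam]

/-- the sheet-forming shape `(1, 1, −2)` is SUPER-parity: `12/7`. -/
theorem isoFeedRatio_sheet : isoFeedRatio (shapeParam 1 1) = 12 / 7 := by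
  norm_num [isoFeedRatio, shapeParam]

/-- the infinite (untruncated) linear flow would give exactly parity: `1 + 1·(s − 1)·0`… recorded as the value of
the retention-1 formula `s + 1·(1 − s) = 1`. -/
theorem linearFlow_parity (s : ℝ) : s + 1 * (1 - s) = 1 := by ring

/-- uniaxial centre with transverse vorticity `|ω| = Λ`, `⟪ω,ē⟫ = 0`: `H = (9/14 + 1/20)Λ² = (97/140)Λ²`
(cross-checked against the direct CAS value, r41/isogauge.py). -/
theorem isoFeed_uniaxial_transverse (Λ : ℝ) : isoFeed Λ (1 / 2) (Λ ^ 2) 0 = 97 / 140 * Λ ^ 2 := by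
  unfold isoFeed; ring

/-- **ParityByShape** (kernel-checked): at the vorticity-free centre of an isotropic straining blob with strain
eigenvalues `Λ ≥ μ ≥ −Λ−μ` (`μ ≥ −Λ/2`), FEED PARITY `H ≥ Λ²` holds iff the strain is sheet-forming beyond
`λ₂/λ₁ = (√3 − 1)/2 ≈ 0.366`. -/
theorem one_le_isoFeedRatio_iff {Λ μ : ℝ} (hΛ : 0 < Λ) (hμ : -Λ / 2 ≤ μ) :
    1 ≤ isoFeedRatio (shapeParam Λ μ) ↔ (Real.sqrt 3 - 1) / 2 * Λ ≤ μ := by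
  have h3 : Real.sqrt 3 ^ 2 = 3 := Real.sq_sqrt (by norm_num)
  have hs : 1 < Real.sqrt 3 := by
    have h := Real.sqrt_lt_sqrt (by norm_num : (0:ℝ) ≤ 1) (by norm_num : (1:ℝ) < 3)
    simpa using h
  have hΛ2 : 0 < 3 * Λ ^ 2 := by positivity
  have key : 2 * μ ^ 2 + 2 * Λ * μ - Λ ^ 2
      = 2 * (μ - (Real.sqrt 3 - 1) / 2 * Λ) * (μ + (Real.sqrt 3 - 1) / 2 * Λ + Λ) := by
    linear_combination (Λ ^ 2 / 2) * h3
  have hpos : 0 < μ + (Real.sqrt 3 - 1) / 2 * Λ + Λ := by nlinarith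
  have step : 1 ≤ isoFeedRatio (shapeParam Λ μ) ↔ 0 ≤ 2 * μ ^ 2 + 2 * Λ * μ - Λ ^ 2 := by
    unfold isoFeedRatio shapeParam
    constructor
    · intro h
      have h1 : 1 ≤ (Λ ^ 2 + μ ^ 2 + (Λ + μ) ^ 2) / (3 * Λ ^ 2) := by linarith
      rw [le_div_iff₀ hΛ2] at h1
      nlinarith
    · intro h
      have h1 : 1 ≤ (Λ ^ 2 + μ ^ 2 + (Λ + μ) ^ 2) / (3 * Λ ^ 2) := by
        rw [le_div_iff₀ hΛ2]; nlinarith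
      linarith
  rw [step, key]
  constructor
  · intro h
    by_contra hlt
    push Not at hlt
    have hneg : μ - (Real.sqrt 3 - 1) / 2 * Λ < 0 := by linarith
    have : 2 * (μ - (Real.sqrt 3 - 1) / 2 * Λ) * (μ + (Real.sqrt 3 - 1) / 2 * Λ + Λ) < 0 := by
      have := mul_neg_of_neg_of_pos hneg hpos
      nlinarith
    linarith
  · intro h
    have h1 : 0 ≤ μ - (Real.sqrt 3 - 1) / 2 * Λ := by linarith
    have := mul_nonneg h1 hpos.le
    nlinarith

/-- with vorticity at the centre, sub-parity needs tube-forming shape AND controlled transverse vorticity: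
`H < Λ²` iff `(5/7)(1 − s)Λ² > (|ω|² − 3⟪ω,ē⟫²)/20`. -/
theorem isoFeed_lt_iff (Λ s ω2 ωe2 : ℝ) :
    isoFeed Λ s ω2 ωe2 < Λ ^ 2 ↔ (ω2 - 3 * ωe2) / 20 < 5 / 7 * (1 - s) * Λ ^ 2 := by
  unfold isoFeed; constructor <;> intro h <;> linarith

/-! ## §2 The exact-derivative identities behind envelope-independence (kernel-checked)

`g(t) = h(t²)` is the strain envelope, `c(t) = k(t²)` the rotation envelope, as functions of the radius `t`. -/

/-- **S-part**: the radial integrand `c_S(t)/t` of `Π_S(0)` is an exact derivative: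
`(1/t)(−(12/7)g·tg′ − (2/7)g·t²g″ − (4/21)(tg′)² + (2/21)tg′·t²g″) = d/dt[−(5/7)g² − (2/7)t g g′ + (1/21)t²g′²]`,
so `∫₀^∞ c_S/t = (5/7)g(0)²` and `Π_S(0) = −(2/5)(5/7)g(0)² dev(S²) = −(2/7)g(0)² dev(S²)`. -/
theorem sPart_exact {g dg : ℝ → ℝ} {t ddg : ℝ} (h1 : HasDerivAt g (dg t) t) (h2 : HasDerivAt dg ddg t) :
    HasDerivAt (fun τ => -(5 / 7) * (g τ * g τ) - 2 / 7 * (τ * g τ * dg τ) + 1 / 21 * (τ * τ * (dg τ * dg τ)))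
      (-(12 / 7) * g t * dg t - 2 / 7 * t * g t * ddg - 4 / 21 * t * (dg t * dg t)
        + 2 / 21 * (t * t) * dg t * ddg) t := by
  have hid : HasDerivAt (id : ℝ → ℝ) 1 t := hasDerivAt_id t
  have hA := (h1.fun_mul h1).const_mul (-(5 / 7) : ℝ)
  have hB := ((hid.fun_mul h1).fun_mul h2).const_mul (2 / 7 : ℝ)
  have hC := ((hid.fun_mul hid).fun_mul (h2.fun_mul h2)).const_mul (1 / 21 : ℝ)
  have := (hA.fun_sub hB).fun_add hC
  simp only [id_eq] at this
  convert this using 1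
  all_goals first | rfl | ring

/-- **W-part**: `c_W(t)/t = −2 c c′ = d/dt[−c²]`, so `∫₀^∞ c_W/t = c(0)²` and `Π_W(0) = −(2/5)c(0)² dev(W²)`. -/
theorem wPart_exact {c : ℝ → ℝ} {t dc : ℝ} (h : HasDerivAt c dc t) :
    HasDerivAt (fun τ => -(c τ * c τ)) (-2 * c t * dc) t := by
  have := (h.fun_mul h).fun_neg
  convert this using 1
  all_goals first | rfl | ring

/-- **cross part** (NOT exact — this is why `γ` keeps its envelope dependence):
`c_×(t)/t = −g c′ + 2g′c + (t/3)(g′c′ + g″c) = d/dt[−g c + (t/3)g′c] + (8/3)g′c`. -/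
theorem crossPart_defect {g dg c : ℝ → ℝ} {t ddg dc : ℝ} (hg : HasDerivAt g (dg t) t)
    (hdg : HasDerivAt dg ddg t) (hc : HasDerivAt c dc t) :
    HasDerivAt (fun τ => -(g τ * c τ) + τ / 3 * dg τ * c τ)
      ((-(g t) * dc + 2 * dg t * c t + t / 3 * (dg t * dc + ddg * c t)) - 8 / 3 * dg t * c t) t := by
  have hid : HasDerivAt (fun τ : ℝ => τ / 3) (1 / 3) t := by
    simpa using (hasDerivAt_id t).div_const 3
  have := (hg.fun_mul hc).fun_neg.fun_add ((hid.fun_mul hdg).fun_mul hc)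
  convert this using 1
  all_goals first | rfl | ring

/-- the cross coefficient on the k = 3 same-envelope uniaxial test (`g = (1−t²)³`, `c = g + tg′/3`):
`γ = −(2/5)(1 + (8/3)(−3/10)) = −2/25`, matching the CAS entry `Π_yz = γ·¾ = −3/50` (r41/isogauge.py). -/
example : -(2 / 5 : ℝ) * (1 + 8 / 3 * (-3 / 10)) = -2 / 25 := by norm_num
example : (-2 / 25 : ℝ) * (3 / 4) = -3 / 50 := by norm_num

/-! ## §3 Typed statements (Props): the law, τ1, the witness -/

/-- support (definition): `p` is THE DECAYING PRESSURE of the slice field `u`: `C²`, the pressure Poisson equation in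
trace form `Δp = −tr(∇u ∘ ∇u)` everywhere, and `p → 0` at infinity (this selects the physical harmonic part: adding a
harmonic quadratic to `p` changes `Π(0)` at will — the far-field freedom). -/
def IsDecayingPressureOf (u : E3 → E3) (p : E3 → ℝ) : Prop :=
  ContDiff ℝ 2 p ∧ (∀ x, Δ p x = -traceCLM ((fderiv ℝ u x).comp (fderiv ℝ u x))) ∧
    Tendsto p (cocompact E3) (𝓝 0)

/-- support (definition): the ISOTROPIC ENVELOPE of the linear field `x ↦ (S + W)x` with profiles `h, k` of `|x|²`
(`dh` = the derivative of `h`): `u(x) = (h(|x|²) + ⅔|x|²h′(|x|²))·Sx − ⅔h′(|x|²)⟪x,Sx⟫·x + k(|x|²)·Wx`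
(`= curl(h(|x|²)·⅓(Sx × x)) + k(|x|²)Wx`; divergence-free for trace-free symmetric `S` and skew `W`). -/
def isoField (S W : E3 →L[ℝ] E3) (h dh k : ℝ → ℝ) (x : E3) : E3 :=
  (h (‖x‖ ^ 2) + 2 / 3 * ‖x‖ ^ 2 * dh (‖x‖ ^ 2)) • S x - (2 / 3 * dh (‖x‖ ^ 2) * ⟪x, S x⟫) • x
    + k (‖x‖ ^ 2) • W x

/-- support (definition): the trace-free part `dev(L) = L − (tr L/3)·I`. -/
def dev (L : E3 →L[ℝ] E3) : E3 →L[ℝ] E3 := L - (traceCLM L / 3) • ContinuousLinearMap.id ℝ E3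

/-- support (definition): the cross coefficient `γ[h,k] = −(2/5)(h(0)k(0) + (8/3)∫₀^∞ h′(s)k(s) ds)`. -/
def crossCoeff (h dh k : ℝ → ℝ) : ℝ := -(2 / 5) * (h 0 * k 0 + 8 / 3 * ∫ s in Ioi (0:ℝ), dh s * k s)

/-- **IsotropicBlobPressureLaw** (statement; proved off-kernel this round — §2 is its analytic heart): for every
trace-free symmetric `S`, skew `W` and smooth compactly supported profiles `h, k`, the decaying pressure of the
isotropic envelope field has centre trace-free Hessian
`Π(0) = −(2/7)h(0)²·dev(S²) − (2/5)k(0)²·dev(W²) + γ[h,k]·(SW − WS)` — the deterministic form of the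
Wilczek–Meneveau law (arXiv:1401.3351), `S²`/`W²` coefficients envelope-free. -/
def IsotropicBlobPressureLaw : Prop :=
  ∀ (S W : E3 →L[ℝ] E3) (h dh k : ℝ → ℝ),
    (∀ x y : E3, ⟪S x, y⟫ = ⟪x, S y⟫) → traceCLM S = 0 → (∀ x y : E3, ⟪W x, y⟫ = -⟪x, W y⟫) →
    ContDiff ℝ ∞ h → (∀ r, HasDerivAt h (dh r) r) → ContDiff ℝ ∞ k →
    HasCompactSupport h → HasCompactSupport k →
    ∀ p : E3 → ℝ, IsDecayingPressureOf (isoField S W h dh k) p →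
      deviatoricHessian p 0 =
        (-(2 / 7) * h 0 ^ 2) • dev (S.comp S) + (-(2 / 5) * k 0 ^ 2) • dev (W.comp W)
          + crossCoeff h dh k • (S.comp W - W.comp S)

/-- **τ1 at regularity `n`** (g32 seed, typed): FEED PARITY AT EVERY GLOBAL STRAIN ARGMAX — for every
`C^n`, compactly supported, divergence-free slice field and its decaying pressure, `Λ² ≤ H` at every global strain
argmax `(x̄, ē)` (tree vocabulary `IsStrainArgmax`, `strainQuad`, `strainFeed` of S37, on the constant-in-time
extension; the currency is exactly D1/D4/D5's hypothesis text at `t = 0`).  `n = ∞` is τ1 proper; parity for `C^m`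
fields implies parity for `C^n` fields when `m ≤ n` (`argmaxFeedParityOf_mono`).  REFUTED at `n = 2` by the
polynomial-envelope witness (kernel path this week) and at `n = ∞` by the bump-envelope witness (off-kernel: law +
argmax certificate): `not_argmaxFeedParityOf_of_witness`. -/
def ArgmaxFeedParityOf (n : ℕ∞) : Prop :=
  ∀ (u : E3 → E3) (p : E3 → ℝ), ContDiff ℝ n u → HasCompactSupport u → IsDivFree u →
    IsDecayingPressureOf u p → ∀ x e : E3, IsStrainArgmax (fun _ => u) 0 x e →
      strainQuad (fun _ => u) 0 x e ^ 2 ≤ strainFeed (fun _ => u) (fun _ => p) 0 x e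

/-- **τ1** proper (smooth fields). -/
abbrev ArgmaxFeedParity : Prop := ArgmaxFeedParityOf ⊤

/-- **SubParityWitnessOf n c**: a `C^n` compactly supported divergence-free slice field whose decaying pressure gives
feed ratio EXACTLY `c` at a genuine global strain argmax with `Λ > 0`.  CLAIMS OF THE ROUND: `SubParityWitnessOf 2
(9/14)` via the uniaxial isotropic blob with envelope `(1−|x|²)₊⁴` (EXPLICIT piecewise pressure: interior polynomial
of degree 18 with 220 rational coefficients, exterior quadrupole + hexadecapole `H₂(x)/|x|⁵ + H₄(x)/|x|⁹`, no
monopole; `C¹` glue on the sphere exact, `C⁶` in fact — r41/pressure_k4.txt) and `SubParityWitnessOf ⊤ (9/14)`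
via the bump `exp(−3s/(1−s))` (the law + argmax certificate r41/argmax_bump2.py); the constant `9/14` is the same
for EVERY envelope (the law).  z²-modulated axisymmetric blobs reach every `c ∈ (0.4934, 9/14]` (r41/scanb.py). -/
def SubParityWitnessOf (n : ℕ∞) (c : ℝ) : Prop :=
  ∃ (u : E3 → E3) (p : E3 → ℝ) (x e : E3), ContDiff ℝ n u ∧ HasCompactSupport u ∧ IsDivFree u ∧
    IsDecayingPressureOf u p ∧ IsStrainArgmax (fun _ => u) 0 x e ∧ 0 < strainQuad (fun _ => u) 0 x e ∧
    strainFeed (fun _ => u) (fun _ => p) 0 x e = c * strainQuad (fun _ => u) 0 x e ^ 2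

/-- parity for rougher fields implies parity for smoother fields. -/
theorem argmaxFeedParityOf_mono {m n : ℕ∞} (h : m ≤ n) : ArgmaxFeedParityOf m → ArgmaxFeedParityOf n := by
  intro hP u p hu hcs hdiv hp x e hmax
  exact hP u p (hu.of_le (by exact_mod_cast h)) hcs hdiv hp x e hmax

/-- a smoother witness is a rougher witness. -/
theorem subParityWitnessOf_mono {m n : ℕ∞} {c : ℝ} (h : m ≤ n) :
    SubParityWitnessOf n c → SubParityWitnessOf m c := by
  rintro ⟨u, p, x, e, hu, hcs, hdiv, hp, hmax, hΛ, hfeed⟩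
  exact ⟨u, p, x, e, hu.of_le (by exact_mod_cast h), hcs, hdiv, hp, hmax, hΛ, hfeed⟩

/-- a sub-parity witness (`c < 1`) refutes τ1 at the same regularity (kernel-checked composition). -/
theorem not_argmaxFeedParityOf_of_witness {n : ℕ∞} {c : ℝ} (hc : c < 1) (hw : SubParityWitnessOf n c) :
    ¬ ArgmaxFeedParityOf n := by
  intro hP
  obtain ⟨u, p, x, e, hu, hcs, hdiv, hp, hmax, hΛ, hfeed⟩ := hw
  have h := hP u p hu hcs hdiv hp x e hmax
  rw [hfeed] at h
  have hsq : 0 < strainQuad (fun _ => u) 0 x e ^ 2 := by positivity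
  nlinarith

/-- in particular a `C^∞` witness refutes τ1 at every regularity. -/
theorem not_argmaxFeedParityOf_of_smooth_witness {n : ℕ∞} {c : ℝ} (hc : c < 1) (hw : SubParityWitnessOf ⊤ c) :
    ¬ ArgmaxFeedParityOf n :=
  not_argmaxFeedParityOf_of_witness hc (subParityWitnessOf_mono le_top hw)

/-- the uniaxial data of the claimed witness: `S = diag(−½, −½, 1)` (top eigenvector `e₃`, `Λ = h(0)`), `W = 0`,
`h(s) = exp(−3s/(1 − s))` for `s < 1`, `0` otherwise (a `C^∞` bump with `h(0) = 1`, `h′(0) = −3`; the steeper `κ = 1`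
member `exp(−s/(1−s))` is NOT a witness — its edge shell carries strain `1.76·h(0)`); first the map
`x ↦ (−x₀/2, −x₁/2, x₂)`. -/
def uniaxialFun (x : E3) : E3 := WithLp.toLp 2 ![-(x 0) / 2, -(x 1) / 2, x 2]

/-- `diag(−½, −½, 1)` as a continuous linear map. -/
def uniaxialS : E3 →L[ℝ] E3 :=
  LinearMap.toContinuousLinearMap
    { toFun := uniaxialFun
      map_add' := fun v w => by ext i; fin_cases i <;> (simp [uniaxialFun]; try ring)
      map_smul' := fun c v => by ext i; fin_cases i <;> (simp [uniaxialFun]; try ring) }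

/-- the bump profile (smooth witness). -/
def bump (s : ℝ) : ℝ := if s < 1 then Real.exp (-(3 * s) / (1 - s)) else 0

/-- its derivative profile. -/
def dbump (s : ℝ) : ℝ := if s < 1 then -(3 / (1 - s) ^ 2) * Real.exp (-(3 * s) / (1 - s)) else 0

/-- the polynomial envelope `(1−s)₊^k` (the `C^{k−2}` witness; `k = 4` is the kernel target). -/
def polyEnv (k : ℕ) (s : ℝ) : ℝ := if s < 1 then (1 - s) ^ k else 0

/-- its derivative profile (valid for `k ≥ 2`). -/
def dpolyEnv (k : ℕ) (s : ℝ) : ℝ := if s < 1 then -(k : ℝ) * (1 - s) ^ (k - 1) else 0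

/-- the smooth witness field (uniaxial isotropic blob, bump envelope). -/
def witnessField : E3 → E3 := isoField uniaxialS 0 bump dbump 0

/-- the `C²` witness field (uniaxial isotropic blob, envelope `(1−|x|²)₊⁴`): a piecewise-polynomial field whose
decaying pressure is EXPLICIT (r41/pressure_k4.txt: `p_in` of degree 18, `p_out = H₂/|x|⁵ + H₄/|x|⁹`). -/
def witnessFieldC2 : E3 → E3 := isoField uniaxialS 0 (polyEnv 4) (dpolyEnv 4) 0

example : bump 0 = 1 := by simp [bump]
example : dbump 0 = -3 := by simp [dbump]
example : polyEnv 4 0 = 1 := by simp [polyEnv]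
example : dpolyEnv 4 0 = -4 := by norm_num [dpolyEnv]

/-! ## §4 Recorded exact constants (r41/*.py, pure-ℚ CAS) -/

/-- centre pressure Hessian of the uniaxial blob: `∇²p(0) = −Λ²·diag(3/7, 3/7, 9/14)` (trace `−3/2·Λ² = Δp(0)
= −|S|²`), `Π(0) = Λ²·diag(1/14, 1/14, −1/7) = −(2/7)·dev(S²)`, `H(0,e₃) = ½Λ² + Λ²/7 = (9/14)Λ²`. -/
example : (3 / 7 : ℝ) + 3 / 7 + 9 / 14 = 3 / 2 ∧ (1 / 2 : ℝ) + 1 / 7 = 9 / 14 ∧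
    (-(2 / 7) : ℝ) * (1 - 1 / 2) = -1 / 7 := by norm_num

/-- z²-modulated axisymmetric blobs `Ψ·(1 + b z²)`, envelope `(1−r²)³`: `H/Λ²(b) = 9/14 − (44/1225)b − (5/1078)b²`;
strict local argmax at the origin iff `b < 3` (`S_zz = 1 − 6ρ² − (9 − 3b)z² + …`); `b = 3` gives `6648/13475 = 0.49336…`. -/
example : (9 / 14 : ℝ) - 44 / 1225 * 3 - 5 / 1078 * 3 ^ 2 = 6648 / 13475 := by norm_num

end Summit.NavierStokesRegularity.NavierStokesRegularity.Theorems.StrainDoors.IsotropicBlob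

end
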